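import Literature.Topology.FourManifolds.BordismFourProofs
import Literature.AlgebraicTopology.SingularHomology.LocalHomologyIso
import Mathlib.Topology.Connected.LocallyPathConnected
import HarnessLib

/-!
# Normalizing an oriented bordism datum: the components of `W` meeting `∂W` (Layer 4 of `Literature.Topology.FourManifolds.isOrientedBordant_iff_signature_eq`)

Sibling proof file of `Literature.Topology.FourManifolds.BordismFourProofs`.  Its hypothesis
`hA1` of `Literature.Topology.FourManifolds.two_mul_boundaryImageRank_eq_of_normalization` asks to replace a homological
bordism datum `(c, w)` (`Literature.Topology.FourManifolds.IsOrientedBordant`: `w ∈ H₅(W, ∂W; ℤ)` with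
`∂w = (inl)_*[M] − (inr)_*[N]`, where `W` may have closed components on which `w` is arbitrary)
by an `Literature.Topology.FourManifolds.OrientedSplitting` (a relative fundamental class on a compact topological manifold
with boundary split as `M ⊔ N`) with the same `r₂`.  Classically one discards the components of
`W` not meeting `∂W`.  This file carries out the topological half of that bookkeeping:

* the **essential part** `W' ⊆ W`, the union of the connected components of `W` meeting `∂W`
  (`Literature.Topology.FourManifolds.Cobordism.essentialPart`): clopen (a compact manifold with boundary is locally connected
  with finitely many components — Mathlib: `Finite (ConnectedComponents _)`; the set-indexed form
  used here is `finite_setOf_connectedComponent`), hence an open submanifold `Literature.Topology.FourManifolds.Cobordism.essentialOpens` which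
  is compact, with boundary `∂W' = ∂W` (Mathlib's `ModelWithCorners.boundary_open`), and the ends
  corestrict to a topological boundary splitting `Literature.Cobordism.essentialSplitting :
  BoundarySplitting n M N ↥W'`;
* the **collapse map** `g : W → W'` (identity on `W'`, constant at a boundary point elsewhere;
  `Literature.Topology.FourManifolds.Cobordism.collapse`), a retraction of the inclusion `j : W' ⊆ W` and a map of pairs
  `(W, ∂W) → (W', ∂W')`; the transported class `w' = g_* w` has
  `∂w' = (iM)_*[M] − (iN)_*[N]` (naturality of `∂`), and `r₂(c) = r₂(W')` because `j^*` is onto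
  (`g ∘ j = id`): `Literature.Topology.FourManifolds.Cobordism.boundaryImageRank_eq_restrictRank_essentialSplitting`.

What remains for `hA1` (next layer): (i) that `w'` is a relative fundamental class of
`(W', ∂W')` — the per-component argument with Spanier Thm. 6.3.5 / Cor. 6.3.10 (named facts of
`LefschetzDuality.lean`) and the locality of local homology (`localHomology.openSubsetIso`,
`LocalHomologyVanishing.lean`); (ii) the separate case `∂W = ∅` (then `M = N = ∅`, `W' = ∅`,
`w' = 0`, both ranks `0`): every boundary-dependent construction below (`collapse`,
`collapseClass`, the rank equality) takes a point `p ∈ W'`, which exists only when `∂W ≠ ∅`.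

Everything here is proved; [folklore] over Milnor, *Lectures on the h-cobordism theorem* (1965),
§1, and Hatcher, *Algebraic Topology* (2002), §2.1 (naturality of the exact sequence of a pair).
-/

open scoped Manifold ContDiff Topology
open Set CategoryTheory

noncomputable section

universe u v

namespace Literature.Topology.FourManifolds

namespace Cobordism

variable {n : ℕ} {M N : Type u} [TopologicalSpace M] [ChartedSpace (EuclideanSpace ℝ (Fin n)) M]
  [TopologicalSpace N] [ChartedSpace (EuclideanSpace ℝ (Fin n)) N]

/-! ### Components of the total space -/

/-- The total space of a cobordism is locally connected (it is charted over the half-space,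
which is locally path connected). [folklore] -/
instance locallyConnectedSpace_W (c : Cobordism n M N) : LocallyConnectedSpace c.W :=
  ChartedSpace.locallyConnectedSpace (EuclideanHalfSpace (n + 1)) c.W

/-- A compact locally connected space has finitely many connected components: here, the total
space of a cobordism, in set-indexed form (Mathlib has the instance `Finite (ConnectedComponents _)`
for compact locally connected spaces). [folklore] -/
theorem finite_setOf_connectedComponent (c : Cobordism n M N) :
    {C : Set c.W | ∃ x, C = connectedComponent x}.Finite := by
  have hcover : (univ : Set c.W) ⊆ ⋃ C ∈ {C : Set c.W | ∃ x, C = connectedComponent x}, C :=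
    fun x _ => mem_iUnion₂.mpr ⟨connectedComponent x, ⟨x, rfl⟩, mem_connectedComponent⟩
  obtain ⟨t, ht, htfin, htcover⟩ := isCompact_univ.elim_finite_subcover_image
    (fun C (hC : C ∈ {C : Set c.W | ∃ x, C = connectedComponent x}) => by
      obtain ⟨x, rfl⟩ := hC
      exact isClopen_connectedComponent.isOpen) hcover
  refine htfin.subset fun C hC => ?_
  obtain ⟨x, rfl⟩ := hC
  obtain ⟨D, hD, hxD⟩ := mem_iUnion₂.mp (htcover (mem_univ x))
  obtain ⟨y, rfl⟩ := ht hD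
  rw [← connectedComponent_eq hxD]
  exact hD

/-! ### The essential part `W'`: components meeting the boundary -/

/-- The **essential part** of the total space of a cobordism: the union of the connected
components of `W` meeting the boundary `∂W` (Milnor 1965, §1: only these components carry the
cobordism; the others are closed manifolds). [folklore] -/
def essentialPart (c : Cobordism n M N) : Set c.W :=
  ⋃ x ∈ (𝓡∂ (n + 1)).boundary c.W, connectedComponent x

/-- The boundary lies in the essential part. [folklore] -/
theorem boundary_subset_essentialPart (c : Cobordism n M N) :
    (𝓡∂ (n + 1)).boundary c.W ⊆ c.essentialPart := fun x hx =>
  mem_iUnion₂.mpr ⟨x, hx, mem_connectedComponent⟩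

/-- The essential part is a union of components: it contains the component of each of its points. [folklore] -/
theorem connectedComponent_subset_essentialPart (c : Cobordism n M N) {x : c.W}
    (hx : x ∈ c.essentialPart) : connectedComponent x ⊆ c.essentialPart := by
  obtain ⟨b, hb, hxb⟩ := mem_iUnion₂.mp hx
  rw [← connectedComponent_eq hxb]
  exact subset_iUnion₂ (s := fun y (_ : y ∈ (𝓡∂ (n + 1)).boundary c.W) => connectedComponent y) b hb

/-- **The essential part is clopen** (a finite union of clopen components). [folklore] -/
theorem isClopen_essentialPart (c : Cobordism n M N) : IsClopen c.essentialPart := by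
  have hfin : {C : Set c.W | ∃ x ∈ (𝓡∂ (n + 1)).boundary c.W, C = connectedComponent x}.Finite :=
    c.finite_setOf_connectedComponent.subset fun C ⟨x, _, hC⟩ => ⟨x, hC⟩
  have e : c.essentialPart =
      ⋃ C ∈ {C : Set c.W | ∃ x ∈ (𝓡∂ (n + 1)).boundary c.W, C = connectedComponent x}, C := by
    ext y
    simp only [essentialPart, mem_iUnion, mem_setOf_eq, exists_prop]
    constructor
    · rintro ⟨x, hx, hy⟩
      exact ⟨_, ⟨x, hx, rfl⟩, hy⟩
    · rintro ⟨C, ⟨x, hx, rfl⟩, hy⟩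
      exact ⟨x, hx, hy⟩
  rw [e]
  exact hfin.isClopen_biUnion fun C ⟨x, _, hC⟩ => hC ▸ isClopen_connectedComponent

/-- The essential part as an open subset of `W` (hence an open submanifold, with Mathlib's
`TopologicalSpace.Opens` manifold structure). [folklore] -/
def essentialOpens (c : Cobordism n M N) : TopologicalSpace.Opens c.W :=
  ⟨c.essentialPart, c.isClopen_essentialPart.isOpen⟩

/-- Membership in `essentialOpens` is membership in `essentialPart`. [folklore] -/
@[simp]
theorem mem_essentialOpens (c : Cobordism n M N) (x : c.W) : x ∈ c.essentialOpens ↔ x ∈ c.essentialPart :=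
  Iff.rfl

/-- The essential part is compact (closed in the compact `W`). [folklore] -/
instance compactSpace_essentialOpens (c : Cobordism n M N) : CompactSpace ↥c.essentialOpens :=
  isCompact_iff_compactSpace.mp c.isClopen_essentialPart.isClosed.isCompact

/-- **`∂W' = ∂W`**: the boundary of the open submanifold `W'` is the trace of the boundary of `W`
(Mathlib's `ModelWithCorners.boundary_open`), i.e. all of `∂W` since `∂W ⊆ W'`. [folklore] -/
theorem boundary_essentialOpens (c : Cobordism n M N) :
    (𝓡∂ (n + 1)).boundary ↥c.essentialOpens = Subtype.val ⁻¹' (𝓡∂ (n + 1)).boundary c.W :=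
  ModelWithCorners.boundary_open

/-- A point of `W'` is a boundary point of `W'` iff it is one of `W`. [folklore] -/
theorem mem_boundary_essentialOpens_iff (c : Cobordism n M N) (x : ↥c.essentialOpens) :
    x ∈ (𝓡∂ (n + 1)).boundary ↥c.essentialOpens ↔ (x : c.W) ∈ (𝓡∂ (n + 1)).boundary c.W := by
  rw [boundary_essentialOpens]; rfl

/-- The incoming end corestricted to the essential part. [folklore] -/
def inlEssential (c : Cobordism n M N) : C(M, ↥c.essentialOpens) where
  toFun x := ⟨c.inl x, c.boundary_subset_essentialPart (c.inl_mem_boundary x)⟩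
  continuous_toFun := c.continuous_inl.subtype_mk _

/-- The outgoing end corestricted to the essential part. [folklore] -/
def inrEssential (c : Cobordism n M N) : C(N, ↥c.essentialOpens) where
  toFun y := ⟨c.inr y, c.boundary_subset_essentialPart (c.inr_mem_boundary y)⟩
  continuous_toFun := c.continuous_inr.subtype_mk _

/-- `inlEssential x = inl x` in `W`. [folklore] -/
@[simp]
theorem coe_inlEssential_apply (c : Cobordism n M N) (x : M) : (c.inlEssential x : c.W) = c.inl x := rfl

/-- `inrEssential y = inr y` in `W`. [folklore] -/
@[simp]
theorem coe_inrEssential_apply (c : Cobordism n M N) (y : N) : (c.inrEssential y : c.W) = c.inr y := rfl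

/-- **The ends split the boundary of the essential part**: `∂W' = M ⊔ N` as a topological
boundary splitting (`Literature.Topology.FourManifolds.BoundarySplitting`; Milnor 1965, §1). [folklore] -/
def essentialSplitting (c : Cobordism n M N) : BoundarySplitting n M N ↥c.essentialOpens where
  iM := c.inlEssential
  iN := c.inrEssential
  injective_iM x y h := c.isSmoothEmbedding_inl.isEmbedding.injective (congrArg Subtype.val h)
  injective_iN x y h := c.isSmoothEmbedding_inr.isEmbedding.injective (congrArg Subtype.val h)
  disjoint_range := by
    refine Set.disjoint_left.mpr ?_
    rintro z ⟨x, rfl⟩ ⟨y, hy⟩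
    exact Set.disjoint_left.mp c.disjoint_range ⟨x, rfl⟩ ⟨y, congrArg Subtype.val hy⟩
  range_union := by
    ext z
    rw [mem_boundary_essentialOpens_iff, ← c.range_inl_union_range_inr]
    constructor
    · rintro (⟨x, rfl⟩ | ⟨y, rfl⟩)
      · exact Or.inl ⟨x, rfl⟩
      · exact Or.inr ⟨y, rfl⟩
    · rintro (⟨x, hx⟩ | ⟨y, hy⟩)
      · exact Or.inl ⟨x, Subtype.ext hx⟩
      · exact Or.inr ⟨y, Subtype.ext hy⟩

/-- Unfolding: the first end of the essential splitting. [folklore] -/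
@[simp]
theorem essentialSplitting_iM (c : Cobordism n M N) : c.essentialSplitting.iM = c.inlEssential := rfl

/-- Unfolding: the second end of the essential splitting. [folklore] -/
@[simp]
theorem essentialSplitting_iN (c : Cobordism n M N) : c.essentialSplitting.iN = c.inrEssential := rfl

/-! ### The collapse map `g : W → W'` -/

/-- The decomposition `W ≅ W' ⊔ (W ∖ W')`: `Literature.AlgebraicTopology.SingularHomology.Homeomorph.sumOfIsClopen` (of
`LocalHomologyIso.lean`) for the clopen `W'`, merely re-typed on the open submanifold
`↥c.essentialOpens` (same underlying set as `c.essentialPart`). [folklore] -/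
abbrev essentialSumHomeomorph (c : Cobordism n M N) : ↥c.essentialOpens ⊕ ↥(c.essentialPartᶜ) ≃ₜ c.W :=
  Literature.AlgebraicTopology.SingularHomology.Homeomorph.sumOfIsClopen c.essentialPart c.isClopen_essentialPart

/-- `essentialSumHomeomorph (inl x) = x` (`Homeomorph.sumOfIsClopen_inl`). [folklore] -/
theorem essentialSumHomeomorph_inl (c : Cobordism n M N) (x : ↥c.essentialOpens) :
    c.essentialSumHomeomorph (Sum.inl x) = (x : c.W) :=
  Literature.AlgebraicTopology.SingularHomology.Homeomorph.sumOfIsClopen_inl c.essentialPart c.isClopen_essentialPart x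

/-- `essentialSumHomeomorph.symm x = inl x` for `x ∈ W'`. [folklore] -/
theorem essentialSumHomeomorph_symm_of_mem (c : Cobordism n M N) (x : c.W) (hx : x ∈ c.essentialPart) :
    c.essentialSumHomeomorph.symm x = Sum.inl ⟨x, hx⟩ :=
  c.essentialSumHomeomorph.injective
    (by rw [Homeomorph.apply_symm_apply, essentialSumHomeomorph_inl])

/-- **The collapse map** `g : W → W'`, the identity on `W'` and constant `p` on `W ∖ W'`
(continuous because `W'` is clopen, through `W ≅ W' ⊔ (W ∖ W')`; used when `∂W ≠ ∅`, with
`p ∈ ∂W`). [folklore] -/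
def collapse (c : Cobordism n M N) (p : ↥c.essentialOpens) : C(c.W, ↥c.essentialOpens) :=
  (⟨Sum.elim id (fun _ => p), continuous_id.sumElim continuous_const⟩ :
      C(↥c.essentialOpens ⊕ ↥(c.essentialPartᶜ), ↥c.essentialOpens)).comp
    (c.essentialSumHomeomorph.symm : C(c.W, ↥c.essentialOpens ⊕ ↥(c.essentialPartᶜ)))

/-- The collapse map is the identity on the essential part. [folklore] -/
theorem collapse_apply_of_mem (c : Cobordism n M N) (p : ↥c.essentialOpens) (x : c.W)
    (hx : x ∈ c.essentialPart) : c.collapse p x = ⟨x, hx⟩ := by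
  change Sum.elim id (fun _ => p) (c.essentialSumHomeomorph.symm x) = _
  rw [c.essentialSumHomeomorph_symm_of_mem x hx]
  rfl

/-- `g ∘ j = id`: the collapse map retracts the inclusion `W' ⊆ W`. [folklore] -/
theorem collapse_comp_val (c : Cobordism n M N) (p : ↥c.essentialOpens) :
    (c.collapse p).comp (⟨Subtype.val, continuous_subtype_val⟩ : C(↥c.essentialOpens, c.W)) =
      ContinuousMap.id _ := by
  ext x
  exact congrArg Subtype.val (c.collapse_apply_of_mem p x x.2)

/-- The collapse map is a map of pairs `(W, ∂W) → (W', ∂W')`. [folklore] -/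
theorem mapsTo_collapse_boundary (c : Cobordism n M N) (p : ↥c.essentialOpens) :
    MapsTo (c.collapse p) ((𝓡∂ (n + 1)).boundary c.W) ((𝓡∂ (n + 1)).boundary ↥c.essentialOpens) := by
  intro x hx
  rw [mem_boundary_essentialOpens_iff, c.collapse_apply_of_mem p x (c.boundary_subset_essentialPart hx)]
  exact hx

/-- On the boundary, `g ∘ inlBoundary = iMB` (the end inclusions are fixed by the collapse). [folklore] -/
theorem subsetRestrict_collapse_comp_inlBoundary (c : Cobordism n M N) (p : ↥c.essentialOpens) :
    (Literature.AlgebraicTopology.SingularHomology.subsetRestrict (c.collapse p) (c.mapsTo_collapse_boundary p)).comp c.inlBoundary =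
      c.essentialSplitting.iMB := by
  ext x
  exact congrArg Subtype.val (c.collapse_apply_of_mem p (c.inl x)
    (c.boundary_subset_essentialPart (c.inl_mem_boundary x)))

/-- On the boundary, `g ∘ inrBoundary = iNB`. [folklore] -/
theorem subsetRestrict_collapse_comp_inrBoundary (c : Cobordism n M N) (p : ↥c.essentialOpens) :
    (Literature.AlgebraicTopology.SingularHomology.subsetRestrict (c.collapse p) (c.mapsTo_collapse_boundary p)).comp c.inrBoundary =
      c.essentialSplitting.iNB := by
  ext y
  exact congrArg Subtype.val (c.collapse_apply_of_mem p (c.inr y)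
    (c.boundary_subset_essentialPart (c.inr_mem_boundary y)))

/-! ### Transporting the relative class and the rank -/

variable {R : Type v} [CommRing R]

/-- The relative class transported to the essential part, `w' = g_* w ∈ H(W', ∂W')`. [folklore] -/
def collapseClass (c : Cobordism n M N) (p : ↥c.essentialOpens) (k : ℕ)
    (w : Literature.AlgebraicTopology.SingularHomology.relativeSingularHomology R R c.W ((𝓡∂ (n + 1)).boundary c.W) k) :
    Literature.AlgebraicTopology.SingularHomology.relativeSingularHomology R R ↥c.essentialOpens ((𝓡∂ (n + 1)).boundary ↥c.essentialOpens) k :=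
  Literature.AlgebraicTopology.SingularHomology.relativeSingularHomology.map R R (c.collapse p) (c.mapsTo_collapse_boundary p) k w

/-- **`∂w' = (iM)_*[M] − (iN)_*[N]`**: the transported class induces the same boundary classes
(naturality of the connecting map `∂`, Hatcher 2002, §2.1). [cite: Hatcher2002, §2.1 (naturality of ∂)] -/
theorem δ_collapseClass (c : Cobordism n M N) (p : ↥c.essentialOpens)
    (w : Literature.AlgebraicTopology.SingularHomology.relativeSingularHomology R R c.W ((𝓡∂ (n + 1)).boundary c.W) (n + 1))
    (a : Literature.AlgebraicTopology.SingularHomology.singularHomology R R M n) (b : Literature.AlgebraicTopology.SingularHomology.singularHomology R R N n)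
    (hw : Literature.AlgebraicTopology.SingularHomology.relativeSingularHomology.δ R R c.W ((𝓡∂ (n + 1)).boundary c.W) n w =
      Literature.AlgebraicTopology.SingularHomology.singularHomology.map R R c.inlBoundary n a - Literature.AlgebraicTopology.SingularHomology.singularHomology.map R R c.inrBoundary n b) :
    Literature.AlgebraicTopology.SingularHomology.relativeSingularHomology.δ R R ↥c.essentialOpens ((𝓡∂ (n + 1)).boundary ↥c.essentialOpens) n
        (c.collapseClass p (n + 1) w) =
      Literature.AlgebraicTopology.SingularHomology.singularHomology.map R R c.essentialSplitting.iMB n a -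
        Literature.AlgebraicTopology.SingularHomology.singularHomology.map R R c.essentialSplitting.iNB n b := by
  rw [collapseClass, ← ModuleCat.comp_apply, ← Literature.AlgebraicTopology.SingularHomology.relativeSingularHomology.δ_naturality, ModuleCat.comp_apply,
    hw, map_sub, ← ModuleCat.comp_apply, ← ModuleCat.comp_apply, ← Literature.AlgebraicTopology.SingularHomology.singularHomology.map_comp,
    ← Literature.AlgebraicTopology.SingularHomology.singularHomology.map_comp, subsetRestrict_collapse_comp_inlBoundary,
    subsetRestrict_collapse_comp_inrBoundary]

/-- `inl = j ∘ iM` for the essential splitting. [folklore] -/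
theorem inl_eq_val_comp_inlEssential (c : Cobordism n M N) :
    (⟨c.inl, c.continuous_inl⟩ : C(M, c.W)) =
      (⟨Subtype.val, continuous_subtype_val⟩ : C(↥c.essentialOpens, c.W)).comp c.inlEssential := rfl

/-- `inr = j ∘ iN` for the essential splitting. [folklore] -/
theorem inr_eq_val_comp_inrEssential (c : Cobordism n M N) :
    (⟨c.inr, c.continuous_inr⟩ : C(N, c.W)) =
      (⟨Subtype.val, continuous_subtype_val⟩ : C(↥c.essentialOpens, c.W)).comp c.inrEssential := rfl

/-- `boundaryRestrict c = restrict (essentialSplitting) ∘ j^*`. [folklore] -/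
theorem boundaryRestrict_eq_restrict_comp (c : Cobordism n M N) (k : ℕ) :
    c.boundaryRestrict R k = (c.essentialSplitting.restrict R k).comp
      (Literature.AlgebraicTopology.SingularHomology.singularCohomology.map R R (⟨Subtype.val, continuous_subtype_val⟩ : C(↥c.essentialOpens, c.W)) k).hom := by
  refine LinearMap.ext fun a => Prod.ext ?_ ?_
  · change Literature.AlgebraicTopology.SingularHomology.freeCohomology.mk (Literature.AlgebraicTopology.SingularHomology.singularCohomology.map R R (⟨c.inl, c.continuous_inl⟩ : C(M, c.W)) k a) =
      Literature.AlgebraicTopology.SingularHomology.freeCohomology.mk (Literature.AlgebraicTopology.SingularHomology.singularCohomology.map R R c.inlEssential k (Literature.AlgebraicTopology.SingularHomology.singularCohomology.map R R _ k a))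
    rw [inl_eq_val_comp_inlEssential, Literature.AlgebraicTopology.SingularHomology.singularCohomology.map_comp, ModuleCat.comp_apply]
  · change Literature.AlgebraicTopology.SingularHomology.freeCohomology.mk (Literature.AlgebraicTopology.SingularHomology.singularCohomology.map R R (⟨c.inr, c.continuous_inr⟩ : C(N, c.W)) k a) =
      Literature.AlgebraicTopology.SingularHomology.freeCohomology.mk (Literature.AlgebraicTopology.SingularHomology.singularCohomology.map R R c.inrEssential k (Literature.AlgebraicTopology.SingularHomology.singularCohomology.map R R _ k a))
    rw [inr_eq_val_comp_inrEssential, Literature.AlgebraicTopology.SingularHomology.singularCohomology.map_comp, ModuleCat.comp_apply]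

/-- `j^* : Hᵏ(W) → Hᵏ(W')` is onto (split by `g^*`, `g ∘ j = id`), when `∂W ≠ ∅`. [folklore] -/
theorem cohomologyMap_val_surjective (c : Cobordism n M N) (p : ↥c.essentialOpens) (k : ℕ) :
    Function.Surjective (Literature.AlgebraicTopology.SingularHomology.singularCohomology.map R R
      (⟨Subtype.val, continuous_subtype_val⟩ : C(↥c.essentialOpens, c.W)) k) := by
  intro x
  refine ⟨Literature.AlgebraicTopology.SingularHomology.singularCohomology.map R R (c.collapse p) k x, ?_⟩
  rw [← ModuleCat.comp_apply, ← Literature.AlgebraicTopology.SingularHomology.singularCohomology.map_comp, collapse_comp_val, Literature.AlgebraicTopology.SingularHomology.singularCohomology.map_id]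
  rfl

/-- **`r₂(c) = r₂(W')`**: discarding the inessential components does not change Thom's rank
(when `∂W ≠ ∅`; `j^*` is onto). [folklore] -/
theorem boundaryImageRank_eq_restrictRank_essentialSplitting (c : Cobordism n M N)
    (p : ↥c.essentialOpens) (k : ℕ) :
    c.boundaryImageRank R k = c.essentialSplitting.restrictRank R k := by
  rw [boundaryImageRank_eq, boundaryImage, boundaryRestrict_eq_restrict_comp,
    LinearMap.range_comp_of_range_eq_top _
      (LinearMap.range_eq_top.2 (c.cohomologyMap_val_surjective (R := R) p k))]
  rfl

end Cobordism

end Literature.Topology.FourManifolds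

end
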